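import Summits.Ventures.Crystal3D.Theorems.StickyWulffConstantCoaxialWallLawOneFccCoreCounts
import Summits.Ventures.Crystal3D.Theorems.StickyWulffConstantCoaxialWallLawOneFccChargeBound
import Summits.Ventures.Crystal3D.Theorems.StickyWulffConstantCoaxialWallLawOneFccTwoFamilyPayers
import Summits.Ventures.Crystal3D.Theorems.StickyWulffConstantCoaxialWallLawOneFccLedger
import HarnessLib

/-!
# The ONE-FCC F_layer: the PER-CELL LAW — two families, one ledger (file (k₃))

HONEST FRAMING. Venture `Summits/Ventures/Crystal3D` (cell `crystal3d-full`); helper `--supports` the crux `CoaxialWallLaw`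
(stmt-Ventures-19481, REGISTERED line `WallLedgerF`) in its role as owner of lane T's debt T-F2 / F_layer, OneFcc half (cf-p1 (civ)/(cxx);
memo HOME/wall-19481-p1/g16/TWO-FAMILY-LEDGER-g16.md).  Inputs `KissingGap δ`, `KissingClassification δ` and the TWIN ROW at the root frame
(`LocalEndRowA`, the shape of `EndRowTwinHalfTurnA … Fr`) BY NAME, with `sF · √(2/3) ≤ 4`; census-free; standard axioms; nothing about the
crux is claimed; F-C1 not moved.

**`oneFcc_core_cell`** — in a clamped cell `Y` (heights `[−2R₀, h+2R₀]`, radius `ρ ≥ R₀ + 2`, `R₀ ≥ 5`) with a FAULTED-or-any bottom plate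
`stacking L s σ` and a SIGN-CONSTANT top plate `stacking L₂ s₂ σ₂` (`σ₂ ≡ ε`) in one twin family (frames `Fr`, `Gf`, dozen identity
`Gf '' D = Fr '' (bM '' D)`), for every slice height `z ∈ [−1, h]` and tilt `ν₂² < 1`:
`Σ'_i √(1−ν₂²)·[σ i = t]·|S_z(ρ) ∩ laySlab L s i| ≤ Σ_{PAY(Y)} (12 − deg) + (864 sF + 430000)(1 + R₀)(1 + h) ρ`.
Proof = `oneFcc_ledger` (…OneFccLedger) fed with `oneFcc_srcA_ledger` / `oneFcc_srcB_ledger` / `oneFcc_exitB_ledger` (…OneFccCoreCounts),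
`oneFcc_charge_le` (…OneFccChargeBound) and the row `oneFcc_twoFamily_sources_le_payerSum` (…OneFccTwoFamilyPayers), on the common window
`K = [⌈(−c−R_tot)/d⌉ − 1, ⌊(−c+R_tot)/d⌋ + 1]`, `c = (L⁻¹ s)₂`, `R_tot = ρ + h + 2R₀ + 2`.
WHAT THIS IS NOT: the frame dictionary / charge law / case split that turn this into `FLayerTwinFamilyOneFccAt` (next file); F-C1 not moved.
-/

noncomputable section

namespace Summit.Ventures.Crystal3D.Theorems

open MeasureTheory Summit.Ventures.Crystal3D Finset
open Literature.MathematicalPhysics.StatisticalMechanics (IsHaggSeq basalMirror basalMirror_apply_coord basalMirror_basalMirror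
  barlowPos barlowStacking barlowPos_mem barlowPos_apply_two constHagg)
open Summit.Ventures.Crystal3D.Cruxes.TextureLiminf.TexShadow (E3 stacking laySlab)
open scoped InnerProductSpace

open scoped Classical in
/-- **THE PER-CELL LAW OF THE ONE-FCC F_layer (two families, one ledger).**  See the module docstring. -/
theorem oneFcc_core_cell (ver : WordVersion) {δ : ℝ} (hg : KissingGap δ) (hc : KissingClassification δ)
    {σ σ₂ : ℤ → ℤ} (hσ : IsHaggSeq σ) (L L₂ : E3 ≃ₗᵢ[ℝ] E3) (s s₂ : E3)
    (Fr : E3 ≃ₗᵢ[ℝ] E3) {t : ℤ} (hFr : (t = 1 ∧ Fr = L) ∨ (t = -1 ∧ Fr = basalMirror.trans L))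
    (Gf : E3 ≃ₗᵢ[ℝ] E3) {ε : ℤ} (hGf : (ε = 1 ∧ Gf = L₂) ∨ (ε = -1 ∧ Gf = basalMirror.trans L₂))
    (hσ₂ : ∀ n : ℤ, σ₂ n = ε)
    (hdozen : (Gf : E3 → E3) '' ↑fccSlots = (fun x => Fr (basalMirror x)) '' ↑fccSlots)
    {sF : ℝ} (hsF : 0 ≤ sF) (hsFd : sF * Real.sqrt (2 / 3) ≤ 4)
    (hrow : LocalEndRowA ver sF ⟨Fr, inPlaneRoots Fr 1⟩
      ⟨((ℝ ∙ EuclideanSpace.single (2 : Fin 3) (1 : ℝ)).reflection).trans Fr,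
        inPlaneRoots (((ℝ ∙ EuclideanSpace.single (2 : Fin 3) (1 : ℝ)).reflection).trans Fr) (-1)⟩)
    (Y P₁ P₂ : Finset E3) (R₀ h ρ zs : ℝ) (hR₀ : 5 ≤ R₀) (hh : 0 ≤ h) (hρ : R₀ + 2 ≤ ρ) (hzs : -1 ≤ zs) (hzs' : zs ≤ h)
    (hY : ∀ p ∈ Y, ∀ q ∈ Y, p ≠ q → 1 ≤ dist p q) (hP₁Y : P₁ ⊆ Y) (hP₂Y : P₂ ⊆ Y)
    (hcellY : ∀ p ∈ Y, -(2 * R₀) ≤ p 2 ∧ p 2 ≤ h + 2 * R₀ ∧ p 0 ^ 2 + p 1 ^ 2 ≤ ρ ^ 2)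
    (hP₁ : ∀ p, p ∈ P₁ ↔ (p ∈ stacking L s σ ∧ -(2 * R₀) ≤ p 2 ∧ p 2 ≤ -R₀ ∧ p 0 ^ 2 + p 1 ^ 2 ≤ ρ ^ 2))
    (hP₂ : ∀ p, p ∈ P₂ ↔ (p ∈ stacking L₂ s₂ σ₂ ∧ h + R₀ ≤ p 2 ∧ p 2 ≤ h + 2 * R₀ ∧ p 0 ^ 2 + p 1 ^ 2 ≤ ρ ^ 2))
    (hS2 : 0 < 1 - (L.symm (EuclideanSpace.single (2 : Fin 3) (1 : ℝ))) 2 ^ 2) :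
    ∑' i : ℤ, (Real.sqrt (1 - (L.symm (EuclideanSpace.single (2 : Fin 3) (1 : ℝ))) 2 ^ 2) * (if σ i = t then (1 : ℝ) else 0)) *
        (volume ({q : E3 | zs ≤ q 2 ∧ q 2 ≤ zs + 1 ∧ q 0 ^ 2 + q 1 ^ 2 ≤ ρ ^ 2} ∩ laySlab L s i)).toReal ≤
      (∑ y ∈ Y.filter (fun y => (Y.filter fun q => dist y q = 1).card ≠ 12 ∧ -R₀ - 2 ≤ y 2 ∧ y 2 ≤ h + R₀ + 2),
          ((12 : ℝ) - ((Y.filter fun q => dist y q = 1).card : ℝ))) +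
        (864 * sF + 430000) * (1 + R₀) * (1 + h) * ρ := by
  have ht : t = 1 ∨ t = -1 := by
    rcases hFr with ⟨h1, -⟩ | ⟨h1, -⟩
    · exact Or.inl h1
    · exact Or.inr h1
  have hρ7 : 7 ≤ ρ := by linarith
  have hd : (0 : ℝ) < Real.sqrt (2 / 3) := Real.sqrt_pos.2 (by norm_num)
  have hd45 : 4 / 5 ≤ Real.sqrt (2 / 3) := by
    rw [show (4 : ℝ) / 5 = Real.sqrt ((4 / 5) ^ 2) by rw [Real.sqrt_sq (by norm_num)]]
    exact Real.sqrt_le_sqrt (by norm_num)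
  have hd1 : Real.sqrt (2 / 3) ≤ 1 := by
    rw [show (1 : ℝ) = Real.sqrt 1 from Real.sqrt_one.symm]; exact Real.sqrt_le_sqrt (by norm_num)
  have hν1 : |(L.symm (EuclideanSpace.single (2 : Fin 3) (1 : ℝ))) 2| ≤ 1 := by
    rw [← sq_le_one_iff_abs_le_one]; linarith
  -- ### the window
  set Rtot : ℝ := ρ + h + 2 * R₀ + 2 with hRtot
  obtain ⟨A, hA⟩ : ∃ A : ℤ, A = ⌈(-(L.symm s) 2 - Rtot) / Real.sqrt (2 / 3)⌉ - 1 := ⟨_, rfl⟩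
  obtain ⟨B, hB⟩ : ∃ B : ℤ, B = ⌊(-(L.symm s) 2 + Rtot) / Real.sqrt (2 / 3)⌋ + 1 := ⟨_, rfl⟩
  have hnormY : ∀ p ∈ Y, ‖p‖ ≤ Rtot := by
    intro p hp
    obtain ⟨h1, h2, h3⟩ := hcellY p hp
    have := norm_le_of_lat_height p (by linarith : (0 : ℝ) ≤ ρ) (by linarith : (0 : ℝ) ≤ h + 2 * R₀) h3
      (abs_le.2 ⟨by linarith, by linarith⟩)
    linarith
  have hbe : basalMirror (h • EuclideanSpace.single (2 : Fin 3) (1 : ℝ)) = -(h • EuclideanSpace.single (2 : Fin 3) (1 : ℝ)) := by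
    ext l
    rw [basalMirror_apply_coord, PiLp.neg_apply]
    split_ifs with hl
    · rw [hl]
    · fin_cases l <;> simp_all
  have hKw : ∀ k i j : ℤ, (L.trans basalMirror) (barlowPos 1 (Real.sqrt (2 / 3)) σ k i j) +
      (basalMirror s + h • EuclideanSpace.single (2 : Fin 3) (1 : ℝ)) ∈
        Y.image (fun p => basalMirror p + h • EuclideanSpace.single (2 : Fin 3) (1 : ℝ)) → k ∈ Finset.Icc A B := by
    intro k i j hk
    obtain ⟨p, hp, hpk⟩ := mem_image.1 hk
    have hp' : p = L (barlowPos 1 (Real.sqrt (2 / 3)) σ k i j) + s := by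
      have h1 : basalMirror p = basalMirror (L (barlowPos 1 (Real.sqrt (2 / 3)) σ k i j) + s) := by
        rw [map_add]
        have h2 := hpk
        rw [LinearIsometryEquiv.trans_apply, ← add_assoc] at h2
        exact add_right_cancel h2
      exact basalMirror.injective h1
    have hIcc := layerIndex_mem_Icc L s (barlowPos 1 (Real.sqrt (2 / 3)) σ k i j) (barlowPos_apply_two 1 _ σ k i j)
      (hp' ▸ hnormY p hp)
    rw [Finset.mem_Icc] at hIcc ⊢
    constructor <;> linarith [hIcc.1, hIcc.2]
  have hWslab : ∀ i : ℤ, ({q : E3 | zs ≤ q 2 ∧ q 2 ≤ zs + 1 ∧ q 0 ^ 2 + q 1 ^ 2 ≤ ρ ^ 2} ∩ laySlab L s i).Nonempty →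
      i ∈ Finset.Icc A (B - 1) := by
    intro i hi
    obtain ⟨q, ⟨hq1, hq2, hq3⟩, r, hr, hrq⟩ := hi
    have hrq' : L r + s = q := hrq
    have hnq : ‖L r + s‖ ≤ Rtot := by
      rw [hrq']
      have := norm_le_of_lat_height q (by linarith : (0 : ℝ) ≤ ρ) (by linarith : (0 : ℝ) ≤ h + 1) hq3
        (abs_le.2 ⟨by linarith, by linarith⟩)
      linarith
    have hIcc := slabIndex_mem_Icc L s r hr hnq
    rw [Finset.mem_Icc] at hIcc ⊢
    constructor <;> linarith [hIcc.1, hIcc.2]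
  -- ### scalar bookkeeping (before any large hypothesis enters the context)
  set Qψ : ℕ := ⌈(h + R₀ + 3) / Real.sqrt (2 / 3)⌉₊ with hQψ
  have hψ : |(zs + R₀ + 2) * (L.symm (EuclideanSpace.single (2 : Fin 3) (1 : ℝ))) 2| ≤ (Qψ : ℝ) * Real.sqrt (2 / 3) := by
    have h1 : (h + R₀ + 3) / Real.sqrt (2 / 3) ≤ (Qψ : ℝ) := Nat.le_ceil _
    rw [div_le_iff₀ hd] at h1
    rw [abs_mul, abs_of_nonneg (by linarith : (0 : ℝ) ≤ zs + R₀ + 2)]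
    have hz0 : (0:ℝ) ≤ zs + R₀ + 2 := by linarith only [hzs, hR₀]
    have := mul_le_mul_of_nonneg_left hν1 hz0
    linarith only [this, h1, hzs', hz0]
  have hPAY : (0 : ℝ) ≤ ∑ y ∈ Y.filter (fun y => (Y.filter fun q => dist y q = 1).card ≠ 12 ∧ -R₀ - 2 ≤ y 2 ∧ y 2 ≤ h + R₀ + 2),
      ((12 : ℝ) - ((Y.filter fun q => dist y q = 1).card : ℝ)) := by
    refine sum_nonneg fun y _ => ?_
    have : ((Y.filter fun q => dist y q = 1).card : ℝ) ≤ 12 := by exact_mod_cast card_filter_dist_eq_one_le_twelve Y hY y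
    linarith
  have hch : ∀ i : ℤ, 0 ≤ (if σ i = t then (1 : ℝ) else 0) ∧ (if σ i = t then (1 : ℝ) else 0) ≤ 1 := fun i => by
    split_ifs <;> norm_num
  have hwA : ∀ k : ℤ, 0 ≤ (if ¬ (σ (k - 1) = -t ∧ σ k = -t) then (1 : ℝ) else 0) ∧
      (if ¬ (σ (k - 1) = -t ∧ σ k = -t) then (1 : ℝ) else 0) ≤ 1 := fun k => by split_ifs <;> norm_num
  have hwN : ∀ k : ℤ, 0 ≤ (if (σ (k - 1) = t ∧ σ k = t) then (1 : ℝ) else 0) ∧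
      (if (σ (k - 1) = t ∧ σ k = t) then (1 : ℝ) else 0) ≤ 1 := fun k => by split_ifs <;> norm_num
  have hd2 : (1 : ℝ) ≤ 2 * Real.sqrt (2 / 3) := by linarith only [hd45]
  have hR : (0 : ℝ) ≤ ρ - 4 := by linarith only [hρ7]
  have hKwcard : ((Finset.Icc A B).card : ℝ) ≤ 5 / 2 * Rtot + 3 := by
    have hl : (-(L.symm s) 2 - Rtot) / Real.sqrt (2 / 3) ≤ (⌈(-(L.symm s) 2 - Rtot) / Real.sqrt (2 / 3)⌉ : ℝ) := Int.le_ceil _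
    have hu : (⌊(-(L.symm s) 2 + Rtot) / Real.sqrt (2 / 3)⌋ : ℝ) ≤ (-(L.symm s) 2 + Rtot) / Real.sqrt (2 / 3) := Int.floor_le _
    have hRtot0 : 0 ≤ Rtot := by rw [hRtot]; linarith
    have hmono : (-(L.symm s) 2 - Rtot) / Real.sqrt (2 / 3) ≤ (-(L.symm s) 2 + Rtot) / Real.sqrt (2 / 3) :=
      div_le_div_of_nonneg_right (by linarith) hd.le
    have hl2 : (⌈(-(L.symm s) 2 - Rtot) / Real.sqrt (2 / 3)⌉ : ℝ) < (-(L.symm s) 2 - Rtot) / Real.sqrt (2 / 3) + 1 :=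
      Int.ceil_lt_add_one _
    have hu2 : (-(L.symm s) 2 + Rtot) / Real.sqrt (2 / 3) - 1 < (⌊(-(L.symm s) 2 + Rtot) / Real.sqrt (2 / 3)⌋ : ℝ) :=
      Int.sub_one_lt_floor _
    have hAB : A ≤ B + 1 := by
      have : (A : ℝ) ≤ (B : ℝ) + 1 := by rw [hA, hB]; push_cast; linarith
      exact_mod_cast this
    have hcardZ : (((Finset.Icc A B).card : ℤ) : ℝ) = (B : ℝ) + 1 - A := by
      rw [Int.card_Icc_of_le A B hAB]; push_cast; ring
    have hcast : ((Finset.Icc A B).card : ℝ) = (((Finset.Icc A B).card : ℤ) : ℝ) := by norm_cast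
    have hw2 : 2 * Rtot / Real.sqrt (2 / 3) ≤ 5 / 2 * Rtot := by
      rw [div_le_iff₀ hd]; nlinarith only [hd45, hRtot0]
    have hsplit : (-(L.symm s) 2 + Rtot) / Real.sqrt (2 / 3) - (-(L.symm s) 2 - Rtot) / Real.sqrt (2 / 3) =
        2 * Rtot / Real.sqrt (2 / 3) := by ring
    rw [hcast, hcardZ, hA, hB]; push_cast; linarith
  have hQψle : (Qψ : ℝ) ≤ 5 / 4 * (h + R₀ + 3) + 1 := by
    have h1 : ((Qψ : ℕ) : ℝ) < (h + R₀ + 3) / Real.sqrt (2 / 3) + 1 := Nat.ceil_lt_add_one (by positivity)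
    have h2 : (h + R₀ + 3) / Real.sqrt (2 / 3) ≤ 5 / 4 * (h + R₀ + 3) := by
      rw [div_le_iff₀ hd]; nlinarith only [hd45, hh, hR₀]
    linarith only [h1, h2]
  -- ### the tilt, its sine and the line density
  have hΦ := four_div_sqrt_le_phi hFr hS2
  have hαle := sum_inPlaneRoots_apply_two_le hFr
  obtain ⟨S2, hS2def⟩ : ∃ S2 : ℝ, S2 = 1 - (L.symm (EuclideanSpace.single (2 : Fin 3) (1 : ℝ))) 2 ^ 2 := ⟨_, rfl⟩
  rw [← hS2def] at hΦ hαle hS2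
  obtain ⟨S, hSdef⟩ : ∃ S : ℝ, S = Real.sqrt S2 := ⟨_, rfl⟩
  rw [← hSdef] at hΦ hαle
  have hSpos : 0 < S := by rw [hSdef]; exact Real.sqrt_pos.2 hS2
  have hSS : S ^ 2 = S2 := by rw [hSdef]; exact Real.sq_sqrt hS2.le
  rw [← hSS] at hΦ
  have hα0 : 0 ≤ ∑ r ∈ inPlaneRoots Fr 1, (Fr r) 2 := sum_nonneg fun r hr => by
    have := (mem_filter.1 hr).2.2; rw [one_mul] at this; exact this.le
  have hΦRS : 4 * (∑ r ∈ inPlaneRoots Fr 1, (Fr r) 2) / (Real.sqrt 3 * S ^ 2) * ((ρ - 4) * S) ≤ 29 * ρ := by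
    have h3 : (17 : ℝ) / 10 ≤ Real.sqrt 3 := by
      rw [show (17 : ℝ) / 10 = Real.sqrt ((17 / 10) ^ 2) by rw [Real.sqrt_sq (by norm_num)]]
      exact Real.sqrt_le_sqrt (by norm_num)
    have e : 4 * (∑ r ∈ inPlaneRoots Fr 1, (Fr r) 2) / (Real.sqrt 3 * S ^ 2) * ((ρ - 4) * S) =
        4 * ((∑ r ∈ inPlaneRoots Fr 1, (Fr r) 2) * (ρ - 4)) / (Real.sqrt 3 * S) := by
      field_simp
    rw [e, div_le_iff₀ (by positivity)]
    have hρ0 : (0 : ℝ) ≤ ρ := by linarith only [hρ7]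
    have h1 : (∑ r ∈ inPlaneRoots Fr 1, (Fr r) 2) * (ρ - 4) ≤ 12 * S * (ρ - 4) := mul_le_mul_of_nonneg_right hαle hR
    have h2 : 4 * ((∑ r ∈ inPlaneRoots Fr 1, (Fr r) 2) * (ρ - 4)) ≤ 48 * S * ρ := by linarith only [h1, hSpos.le]
    have h4 : 48 * S * ρ ≤ 29 * ρ * (Real.sqrt 3 * S) := by
      have hρS : 0 ≤ ρ * S := mul_nonneg hρ0 hSpos.le
      have := mul_le_mul_of_nonneg_left h3 hρS
      linarith only [this, hρS]
    linarith only [h2, h4]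
  have hΦpos : 0 ≤ 4 * (∑ r ∈ inPlaneRoots Fr 1, (Fr r) 2) / (Real.sqrt 3 * S ^ 2) := le_trans (by positivity) hΦ
  have hΦRS0 : 0 ≤ 4 * (∑ r ∈ inPlaneRoots Fr 1, (Fr r) 2) / (Real.sqrt 3 * S ^ 2) * ((ρ - 4) * S) :=
    mul_nonneg hΦpos (mul_nonneg hR hSpos.le)
  have hQψ0 : (0 : ℝ) ≤ (Qψ : ℝ) + 2 := by have : (0 : ℝ) ≤ (Qψ : ℝ) := Nat.cast_nonneg _; linarith only [this]
  have hprod : 4 * (∑ r ∈ inPlaneRoots Fr 1, (Fr r) 2) / (Real.sqrt 3 * S ^ 2) * ((ρ - 4) * S) * ((Qψ : ℝ) + 2) ≤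
      29 * ρ * (5 / 4 * (h + R₀ + 3) + 3) :=
    mul_le_mul hΦRS (by linarith only [hQψle]) hQψ0 (by linarith only [hρ7])
  have hπρ : Real.pi * (8 * ρ) ≤ 32 * ρ := by nlinarith only [Real.pi_le_four, hρ7]
  have hdd : 42 * Real.sqrt (2 / 3) * (ρ - 4) ≤ 42 * ρ := by nlinarith only [hd1, hR, hd]
  have h7 : (1 : ℝ) ≤ ρ / 7 := by rw [le_div_iff₀ (by norm_num)]; linarith only [hρ7]
  have hh7 : h ≤ h * ρ / 7 := by nlinarith only [h7, hh]
  have hR7 : R₀ ≤ R₀ * ρ / 7 := by nlinarith only [h7, hR₀]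
  have hK' : ((Finset.Icc A B).card : ℝ) ≤ 5 / 2 * ρ + 5 / 2 * h + 5 * R₀ + 8 := by rw [hRtot] at hKwcard; linarith only [hKwcard]
  have hK0 : (0 : ℝ) ≤ ((Finset.Icc A B).card : ℝ) := Nat.cast_nonneg _
  have hsFρ : 0 ≤ sF * ρ := mul_nonneg hsF (by linarith only [hρ7])
  -- ### the row, the three counts, the charge (large terms enter the context only now)
  have hF7 := oneFcc_twoFamily_sources_le_payerSum ver hg hc hσ L L₂ s s₂ Fr hFr Gf hGf hσ₂ hdozen
    ((((ℝ ∙ EuclideanSpace.single (2 : Fin 3) (1 : ℝ)).reflection).trans Fr).trans basalMirror) rfl hsF hrow Y P₁ P₂ R₀ h ρ hR₀ hρ hY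
    hP₁Y hP₂Y hcellY hP₁ hP₂
  have hA1 := oneFcc_srcA_ledger L s Fr hFr P₁ R₀ h ρ zs (by linarith only [hR₀]) hh (by linarith only [hρ7]) hP₁ (Finset.Icc A B)
  have hE1 := oneFcc_exitB_ledger (σ := σ) L s Fr hFr Y R₀ h ρ zs (by linarith only [hρ7]) hY (Finset.Icc A B) hKw
  obtain ⟨ψ', hψ', hB1⟩ := oneFcc_srcB_ledger L L₂ s s₂ Fr hFr Gf hGf hσ₂ hdozen P₂ R₀ h ρ zs (by linarith only [hR₀]) hh
    (by linarith only [hρ7]) hP₂ (Finset.Icc A B)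
  have hQ1 := oneFcc_charge_le L s (fun i => if σ i = t then (1 : ℝ) else 0) hch ρ zs (by linarith only [hρ7])
    (by rw [← hS2def]; exact hS2) (Finset.Icc A (B - 1)) hWslab
  rw [← hS2def] at hA1 hE1 hB1 hQ1 ⊢
  rw [← hSdef] at hQ1 ⊢
  rw [← hSS] at hA1 hE1 hB1 hQ1
  have hled := oneFcc_ledger (ch := fun i => if σ i = t then (1 : ℝ) else 0)
    (wA := fun k => if ¬ (σ (k - 1) = -t ∧ σ k = -t) then (1 : ℝ) else 0)
    (wN := fun k => if (σ (k - 1) = t ∧ σ k = t) then (1 : ℝ) else 0) (Qψ := Qψ)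
    (Erow := (3456 * sF + 1710720) * ρ + 18 * ((Finset.Icc A B).card : ℝ))
    hd hd2 hSpos hR hΦ hψ hψ' hsFd hPAY hch hwA hwN (fun k => oneFcc_weights hσ ht k) hA1 hB1 hE1 hQ1 (by linarith only [hF7])
  -- ### collect
  have hbr0 : 0 ≤ (3456 * sF + 1710720) * ρ + 18 * ((Finset.Icc A B).card : ℝ) + (9 * ((Finset.Icc A B).card : ℝ) + 1728 * ρ) +
      9 * ((Finset.Icc A B).card : ℝ) +
      6 * (4 * (∑ r ∈ inPlaneRoots Fr 1, (Fr r) 2) / (Real.sqrt 3 * S ^ 2) * ((ρ - 4) * S)) * ((Qψ : ℝ) + 2) := by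
    have hX := mul_nonneg hΦRS0 hQψ0
    linarith only [hX, hΦRS0, hK0, hsFρ, hρ7]
  have hmain : Real.sqrt (2 / 3) / 4 * ((3456 * sF + 1710720) * ρ + 18 * ((Finset.Icc A B).card : ℝ) +
      (9 * ((Finset.Icc A B).card : ℝ) + 1728 * ρ) + 9 * ((Finset.Icc A B).card : ℝ) +
      6 * (4 * (∑ r ∈ inPlaneRoots Fr 1, (Fr r) 2) / (Real.sqrt 3 * S ^ 2) * ((ρ - 4) * S)) * ((Qψ : ℝ) + 2)) ≤
      1 / 4 * ((3456 * sF + 1710720) * ρ + 18 * ((Finset.Icc A B).card : ℝ) +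
      (9 * ((Finset.Icc A B).card : ℝ) + 1728 * ρ) + 9 * ((Finset.Icc A B).card : ℝ) +
      6 * (4 * (∑ r ∈ inPlaneRoots Fr 1, (Fr r) 2) / (Real.sqrt 3 * S ^ 2) * ((ρ - 4) * S)) * ((Qψ : ℝ) + 2)) :=
    mul_le_mul_of_nonneg_right (by linarith only [hd1]) hbr0
  have hρ0 : (0 : ℝ) ≤ ρ := by linarith only [hρ7]
  have hR00 : (0 : ℝ) ≤ R₀ := by linarith only [hR₀]
  have hnn1 : 0 ≤ sF * R₀ * ρ := mul_nonneg (mul_nonneg hsF hR00) hρ0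
  have hnn2 : 0 ≤ sF * h * ρ := mul_nonneg (mul_nonneg hsF hh) hρ0
  have hnn3 : 0 ≤ sF * R₀ * h * ρ := mul_nonneg (mul_nonneg (mul_nonneg hsF hR00) hh) hρ0
  have hnn4 : 0 ≤ R₀ * h * ρ := mul_nonneg (mul_nonneg hR00 hh) hρ0
  linarith only [hled, hmain, hprod, hK', hK0, h7, hh7, hR7, hπρ, hdd, hsFρ, hnn1, hnn2, hnn3, hnn4, hsF, hh, hR₀, hρ7, hΦRS0]

end Summit.Ventures.Crystal3D.Theorems

end
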